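import Literature.MathematicalPhysics.QuantumFieldTheory.Balaban1983to89.B9Eq349ConjugatedProjectionDifferenceSqrtKappa
import Literature.MathematicalPhysics.QuantumFieldTheory.Balaban1983to89.B9Eq349ConjugatedDPChainTower

/-!
# `Balaban1983to89.B9Eq349ConjugatedProjectionDifferenceChainTower` — T. Bałaban, *Propagators for lattice gauge theories in a background field*, Commun.
# Math. Phys. **99** (1985) 389–434 [Balaban1985BackgroundPropagators] (3.21)∕(3.25) p. 394 (with (3.16)∕(3.24) pp. 393–394), (3.49) p. 399, Thm 3.2 (3.48)
# p. 398, Thm 3.11 p. 416: **THE LETTER `dR` OF ROAD ΔA-CT AT THE TOWER — `‖S R_k(U) S⁻¹ x − R_k(U)x‖ ≤ (15·s_A·β∕√κ₁)·‖x‖` AT EVERY HEIGHT `n`**: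
# `B9Eq349ConjugatedProjectionDifferenceSqrtKappa.norm_conjCompl_sub_compl_le` (t4-ne9-idea-1 g141's kernel C) with every letter discharged exactly as this
# lineage's `B9Eq349ConjugatedDPChainTower.norm_conjProjk_chain_le_two` discharges those of `norm_conjProj_one_sub_RofUk_le_two` (`δ± = β·s_A` by
# `norm_Akp_sub_Ak_le` ∕ `norm_Akm_sub_Ak_le`, `P_M`∕`P_N` by `exists_range_proj`, the four unconjugated letters by `B9Eq349ConjugatedProjectionChainTower` §1) —
# the tower twin of `B9Eq349ConjugatedProjectionDifferenceChain`, the supplier of `B9Eq326ConjugatedDeltaATower`'s `dR`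

statement-level skeleton of published theorems with citation tags; proofs where landed; nothing here is a claim about the Yang–Mills mass gap

CITATION HEADER (lean-in-tree rule).  Audit cell `pub-balaban`, sub-cell `t4`, BINDER row NE9; filed by NE9 formalisation-swarm leaf prover 03
(`b2b-balaban-t4-ne9-formalise-leaf-03`, gen 75).  Imports this lineage's `B9Eq349ConjugatedProjectionDifferenceSqrtKappa` and `B9Eq349ConjugatedDPChainTower`
(gen 74; through it `B9Eq349ConjugatedProjectionChainTower`, `…DPChainLettersTower`).  Sources READ first-hand: [Balaban1985BackgroundPropagators] p. 394
(3.21)∕(3.25), pp. 393–394 (3.16)∕(3.24), p. 399 (3.49), p. 398 Thm 3.2, p. 416 Thm 3.11.  The conjugation is the ROUTE's Combes–Thomas substitute; nothing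
of print's is asserted.

WHAT IS PROVED (sorry-free; proof lane — no `def`; [folklore] composition BY NAME).
* **`norm_conjRofUk_sub_RofUk_le_sqrtKappa`** — `‖S(R_k(U)(S⁻¹x)) − R_k(U)x‖ ≤ ((6 + 9)·β·s_A∕√κ₁)·‖x‖`, every height `n`.
HONEST SCOPE.  Symbolic composition; `γ`, `κ₁`, `M`, `C_Q`, the windows are LETTERS (per height); no decay rate; ONE letter of ONE sub-step, NOT NE9 (cell
pub-balaban: NE9 NOT PRINTED ∕ NOT PROVED; «NE9 ⇐ the named binders»; row WALLED ON A MODEL (O-NE9-1; #5 UNRULED); spine PROVED 0∕9; rung (B)+1 on a finite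
T⁴ — NOT infinite volume, NOT mass gap, NOT BetaPertH, NOT Clay; HONEST DEPENDENCY: continuum YM on T⁴ ⇐ BetaPertH ∧ nine spine estimates (0/9 proved);
BetaPertH ⇐ (D1) ∧ (D4) ∧ CAP+tail).  NEW file; nothing modified.  Net new unproved facts: 0.
-/

noncomputable section

set_option autoImplicit false

open scoped InnerProductSpace ComplexConjugate

namespace Literature.MathematicalPhysics.QuantumFieldTheory.Balaban1983to89.B9Eq349ConjugatedProjectionDifferenceChainTower

open B4Sect5Torus (TSite)
open B9SectCLatticeCarrier (Bond bpos btgt)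
open B9Eq311L2Pairing (WL2)
open B9Eq319QprimeTorus (fineP)
open B11Eq103H1Complex (SiteL2K BondL2K greenK covDerivL2K covLaplaceSiteK adjoint_covDerivL2K apply_greenK greenK_apply)
open B7Prop1Explicit (U1)
open B9Eq310HessianOperator (adTransportW)
open B9Eq315QTower (towerP)
open B9Eq316TowerFlatIsOneStep (siteCast towerP_eq_fineP_pow)
open B9Eq319QprimeTorus (blockCoord)
open B9Eq326OperatorTower (QprimeTowerW RofUk)
open B9Eq324DeltaPrimeATower (laplacePrimeAk GpOfUk)
open B9Eq325ProjFormulaTower (QGGQk_pos)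
open B9Eq349ConjugatedProjectionChainTower (one_sub_RofUk_apply_eq one_sub_RofUk_fix inner_one_sub_RofUk_left sq_mul_norm_sq_le_norm_GQk_sq)
open B9Eq349ConjugatedDPChainTower (norm_Akp_sub_Ak_le norm_Akm_sub_Ak_le)
open B9Eq349ConjugatedProjectionDifferenceSqrtKappa (norm_conjCompl_sub_compl_le)
open B9Eq324ConjugatedFormDifference (inner_Hp hHD_of_structure hHAp_of_structure inner_Qdp_eq norm_Qm_le hHH_of_structure)
open B9Eq349ConjugatedRangeEnergy (norm_conjDP_le_two_rinv inner_Psm_eq Psdp_Qdp_eq hCPsi_of_letter adjoint_apply_adjoint_of_leftInverse)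
open B9Eq349ConjugatedGreenLetters (norm_Gk_Qk'_sub_G_adjQ_le)
open B9Eq311PointwiseMultipliers (exists_range_proj)
open B9Eq349ConjugatedDPChainLetters (SGinv_SG SG_SGinv norm_Dp_sub_le norm_Dm_sub_le norm_Dp'_sub_le norm_Dm'_sub_le)
open B9Eq349ConjugatedDPChainLettersTower (S_Sinv Sinv_S SBinv_SB norm_QpTower_sub_le norm_QmTower_sub_le norm_QpTower'_sub_le
  laplacePrimeAk_apply_eq laplacePrimeAk_GpOfUk_apply GpOfUk_laplacePrimeAk_apply conjHk_plus_apply conjHk_plus_conjGk conjGk_plus_conjHk)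
open B9Eq311PointwiseMultipliers (norm_adjoint_conj_sub_le)

variable {d : ℕ} {L : ℕ} [NeZero L] {m : Fin d → ℕ} [∀ i, NeZero (m i)] {n : ℕ}
  {𝔸 : Type*} [NormedRing 𝔸] [NormedAlgebra ℂ 𝔸] [CompleteSpace 𝔸] [NormOneClass 𝔸]
  {W : Type*} [NormedAddCommGroup W] [InnerProductSpace ℂ W] [FiniteDimensional ℂ W] {φ : W ≃ₗ[ℂ] 𝔸} {Mφ Mφ' : ℝ}
  (hφ : ∀ w, ‖φ w‖ ≤ Mφ * ‖w‖) (hφ' : ∀ X, ‖φ.symm X‖ ≤ Mφ' * ‖X‖) (hMφ : 0 ≤ Mφ) (hMφ' : 0 ≤ Mφ')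
  {c₀ : ℝ} [Fact (0 < c₀)] {η : ℝ} (hη : 0 < η) {U : Bond d (towerP L m (n + 1)) → 𝔸ˣ} (hU : ∀ b, U b ∈ U1 𝔸)
  {c₁ : ℝ} [Fact (0 < c₁)] {a' : ℝ} (ha' : 0 ≤ a')
  (hRS : ∀ (b : Bond d (towerP L m (n + 1))) (v u : W), ⟪adTransportW φ U b v, u⟫_ℂ = ⟪v, adTransportW φ (fun b => (U b)⁻¹) b u⟫_ℂ)
  (hpos' : ∀ x : SiteL2K ℂ d (towerP L m (n + 1)) c₀ W, x ≠ 0 → 0 < RCLike.re ⟪x, laplacePrimeAk L m n φ η U a' (c₁ := c₁) x⟫_ℂ)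
  {CQ : ℝ} (hCQ : 0 ≤ CQ)
  (hQ : ∀ s, ‖((WL2.linearEquiv ℂ ℂ (fun _ : TSite d m => c₁)).symm.toLinearMap ∘ₗ QprimeTowerW L m n φ U (c₀ := c₀)) s‖ ≤ CQ * ‖s‖)
  -- the conjugation: cut-offs and the six multipliers
  {κ : ℂ} {ℓ ℓ' : ℝ} (hℓ : 0 ≤ ℓ) (hℓ' : 0 ≤ ℓ') {χ : TSite d (towerP L m (n + 1)) → ℝ} {χ' : TSite d m → ℝ}
  (hχ : ∀ b : Bond d (towerP L m (n + 1)), |χ (bpos b) - χ (btgt b)| ≤ ℓ * η)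
  (hχ' : ∀ (y : TSite d m) (x : TSite d (towerP L m (n + 1))),
    blockCoord (L ^ (n + 1)) m (siteCast (towerP_eq_fineP_pow L m (n + 1)) x) = y → |χ' y - χ x| ≤ ℓ') (hwin : ‖κ‖ * ℓ * η ≤ 1) (hwin' : ‖κ‖ * ℓ' ≤ 1)
  {S Sinv : SiteL2K ℂ d (towerP L m (n + 1)) c₀ W →ₗ[ℂ] SiteL2K ℂ d (towerP L m (n + 1)) c₀ W}
  (hS : ∀ (f : SiteL2K ℂ d (towerP L m (n + 1)) c₀ W) (x : TSite d (towerP L m (n + 1))),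
    WL2.equiv ℂ (fun _ : TSite d (towerP L m (n + 1)) => c₀) W (S f) x = Complex.exp (κ * (χ x : ℂ)) • WL2.equiv ℂ (fun _ : TSite d (towerP L m (n + 1)) => c₀) W f x)
  (hSinv : ∀ (f : SiteL2K ℂ d (towerP L m (n + 1)) c₀ W) (x : TSite d (towerP L m (n + 1))),
    WL2.equiv ℂ (fun _ : TSite d (towerP L m (n + 1)) => c₀) W (Sinv f) x =
      Complex.exp (-(κ * (χ x : ℂ))) • WL2.equiv ℂ (fun _ : TSite d (towerP L m (n + 1)) => c₀) W f x)
  {SB SBinv : BondL2K ℂ d (towerP L m (n + 1)) c₀ W →ₗ[ℂ] BondL2K ℂ d (towerP L m (n + 1)) c₀ W}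
  (hSB : ∀ (g : BondL2K ℂ d (towerP L m (n + 1)) c₀ W) (b : Bond d (towerP L m (n + 1))),
    WL2.equiv ℂ (fun _ : Bond d (towerP L m (n + 1)) => c₀) W (SB g) b = Complex.exp (κ * (χ (bpos b) : ℂ)) • WL2.equiv ℂ (fun _ : Bond d (towerP L m (n + 1)) => c₀) W g b)
  (hSBinv : ∀ (g : BondL2K ℂ d (towerP L m (n + 1)) c₀ W) (b : Bond d (towerP L m (n + 1))),
    WL2.equiv ℂ (fun _ : Bond d (towerP L m (n + 1)) => c₀) W (SBinv g) b =
      Complex.exp (-(κ * (χ (bpos b) : ℂ))) • WL2.equiv ℂ (fun _ : Bond d (towerP L m (n + 1)) => c₀) W g b)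
  {SG SGinv : SiteL2K ℂ d m c₁ W →ₗ[ℂ] SiteL2K ℂ d m c₁ W}
  (hSG : ∀ (g : SiteL2K ℂ d m c₁ W) (y : TSite d m),
    WL2.equiv ℂ (fun _ : TSite d m => c₁) W (SG g) y = Complex.exp (κ * (χ' y : ℂ)) • WL2.equiv ℂ (fun _ : TSite d m => c₁) W g y)
  (hSGinv : ∀ (g : SiteL2K ℂ d m c₁ W) (y : TSite d m),
    WL2.equiv ℂ (fun _ : TSite d m => c₁) W (SGinv g) y = Complex.exp (-(κ * (χ' y : ℂ))) • WL2.equiv ℂ (fun _ : TSite d m => c₁) W g y)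




include hφ hφ' hMφ hMφ' hη hU ha' hRS hCQ hQ hℓ hℓ' hχ hχ' hwin hwin' hS hSinv hSB hSBinv hSG hSGinv in
/-- **`‖S R_k(U) S⁻¹ x − R_k(U)x‖ ≤ (15·β·s_A∕√κ₁)·‖x‖` AT THE TOWER, every height** — `norm_conjCompl_sub_compl_le` with `R := R_k(U)`, `P := 1 − R_k(U)`, the four
unconjugated letters by `B9Eq349ConjugatedProjectionChainTower` §1, `S^{−†} := (S⁻¹)†`, `δ± = β·s_A` by `norm_Akp_sub_Ak_le` ∕ `norm_Akm_sub_Ak_le`, `P_M`∕`P_N` by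
`exists_range_proj`, on the size window `12·s_A·β ≤ √κ₁` — the letter `dR` of `B9Eq326ConjugatedDeltaATower.norm_conjG1k_le` with `ρ = 15·β·s_A∕√κ₁`.
[cite: Balaban1985BackgroundPropagators, (3.21) p.394, (3.25) p.394, (3.49) p.399, Thm 3.2 (3.48) p.398, Thm 3.11 p.416] -/
theorem norm_conjRofUk_sub_RofUk_le_sqrtKappa {γ κ₁ M β : ℝ} (hγ : 0 < γ) (hγ1 : γ ≤ 1) (hκ₁ : 0 < κ₁) (hM : 0 ≤ M) (hβ : 0 ≤ β) (hβ1 : β ≤ 1)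
    (coercive : ∀ f : SiteL2K ℂ d (towerP L m (n + 1)) c₀ W, γ * ‖f‖ ^ 2 ≤ ‖(covDerivL2K ℂ c₀ ((η : ℂ))⁻¹ (adTransportW φ U)) f‖ ^ 2 +
      a' * ‖((WL2.linearEquiv ℂ ℂ (fun _ : TSite d m => c₁)).symm.toLinearMap ∘ₗ QprimeTowerW L m n φ U (c₀ := c₀)) f‖ ^ 2)
    (hκ : ∀ ψ : SiteL2K ℂ d m c₁ W, κ₁ * ‖ψ‖ ^ 2 ≤ RCLike.re ⟪ψ,
      (((WL2.linearEquiv ℂ ℂ (fun _ : TSite d m => c₁)).symm.toLinearMap ∘ₗ QprimeTowerW L m n φ U (c₀ := c₀)) ∘ₗ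
        GpOfUk L m n φ η U a' (c₁ := c₁) hpos' ∘ₗ GpOfUk L m n φ η U a' (c₁ := c₁) hpos' ∘ₗ
        LinearMap.adjoint ((WL2.linearEquiv ℂ ℂ (fun _ : TSite d m => c₁)).symm.toLinearMap ∘ₗ QprimeTowerW L m n φ U (c₀ := c₀))) ψ⟫_ℂ)
    (hMQ : ∀ s : SiteL2K ℂ d (towerP L m (n + 1)) c₀ W, ‖((WL2.linearEquiv ℂ ℂ (fun _ : TSite d m => c₁)).symm.toLinearMap ∘ₗ QprimeTowerW L m n φ U (c₀ := c₀)) s‖ ≤ M * ‖s‖)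
    (hβD : 2 * ‖κ‖ * ℓ * (Mφ * Mφ') * Real.sqrt d ≤ β) (hβQ : 2 * ‖κ‖ * ℓ' * CQ ≤ β)
    (small : 3 * (1 + a') * β ^ 2 ≤ γ / 4) (hwinκ : 12 * (β * (4 / γ + M * ((4 / γ) ^ 2 * (3 + a' * (2 * M + 1))))) ≤ Real.sqrt κ₁)
    (x : SiteL2K ℂ d (towerP L m (n + 1)) c₀ W) :
    ‖S (RofUk L m n φ η U (c₀ := c₀) (Sinv x)) - RofUk L m n φ η U (c₀ := c₀) x‖ ≤
      (6 * (β * (4 / γ + M * ((4 / γ) ^ 2 * (3 + a' * (2 * M + 1))))) + 9 * (β * (4 / γ + M * ((4 / γ) ^ 2 * (3 + a' * (2 * M + 1)))))) /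
        Real.sqrt κ₁ * ‖x‖ := by
  obtain ⟨PM, Tp, hPAp, hfixp, hsap⟩ := exists_range_proj (𝕜 := ℂ) (S ∘ₗ (GpOfUk L m n φ η U a' (c₁ := c₁) hpos' ∘ₗ
    LinearMap.adjoint ((WL2.linearEquiv ℂ ℂ (fun _ : TSite d m => c₁)).symm.toLinearMap ∘ₗ QprimeTowerW L m n φ U (c₀ := c₀))) ∘ₗ SGinv)
  obtain ⟨PN, Tm, hPAm, hfixm, hsam⟩ := exists_range_proj (𝕜 := ℂ) (LinearMap.adjoint Sinv ∘ₗ (GpOfUk L m n φ η U a' (c₁ := c₁) hpos' ∘ₗ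
    LinearMap.adjoint ((WL2.linearEquiv ℂ ℂ (fun _ : TSite d m => c₁)).symm.toLinearMap ∘ₗ QprimeTowerW L m n φ U (c₀ := c₀))) ∘ₗ LinearMap.adjoint SG)
  have hsA0 : 0 ≤ β * (4 / γ + M * ((4 / γ) ^ 2 * (3 + a' * (2 * M + 1)))) := by positivity
  have hdual : ∀ x y, ⟪LinearMap.adjoint Sinv x, S y⟫_ℂ = ⟪x, y⟫_ℂ := fun x y => by
    rw [LinearMap.adjoint_inner_left, Sinv_S hS hSinv]
  have hV : ∀ g, S ((GpOfUk L m n φ η U a' (c₁ := c₁) hpos' ∘ₗ LinearMap.adjoint ((WL2.linearEquiv ℂ ℂ (fun _ : TSite d m => c₁)).symm.toLinearMap ∘ₗ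
      QprimeTowerW L m n φ U (c₀ := c₀))) g) = (S ∘ₗ (GpOfUk L m n φ η U a' (c₁ := c₁) hpos' ∘ₗ LinearMap.adjoint ((WL2.linearEquiv ℂ ℂ (fun _ : TSite d m => c₁)).symm.toLinearMap ∘ₗ
      QprimeTowerW L m n φ U (c₀ := c₀))) ∘ₗ SGinv) (SG g) := fun g => by simp only [LinearMap.comp_apply, SGinv_SG hSG hSGinv]
  have hAm : ∀ h, (LinearMap.adjoint Sinv ∘ₗ (GpOfUk L m n φ η U a' (c₁ := c₁) hpos' ∘ₗ LinearMap.adjoint ((WL2.linearEquiv ℂ ℂ (fun _ : TSite d m => c₁)).symm.toLinearMap ∘ₗ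
      QprimeTowerW L m n φ U (c₀ := c₀))) ∘ₗ LinearMap.adjoint SG) h = LinearMap.adjoint Sinv ((GpOfUk L m n φ η U a' (c₁ := c₁) hpos' ∘ₗ
      LinearMap.adjoint ((WL2.linearEquiv ℂ ℂ (fun _ : TSite d m => c₁)).symm.toLinearMap ∘ₗ QprimeTowerW L m n φ U (c₀ := c₀))) (LinearMap.adjoint SG h)) := fun _ => rfl
  have h := norm_conjCompl_sub_compl_le (𝕜 := ℂ) (R := RofUk L m n φ η U (c₀ := c₀)) (P := LinearMap.id - RofUk L m n φ η U (c₀ := c₀))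
    (A := GpOfUk L m n φ η U a' (c₁ := c₁) hpos' ∘ₗ
      LinearMap.adjoint ((WL2.linearEquiv ℂ ℂ (fun _ : TSite d m => c₁)).symm.toLinearMap ∘ₗ QprimeTowerW L m n φ U (c₀ := c₀)))
    (T := fun f => greenK _ (QGGQk_pos L m n φ c₀ η U c₁ a' hRS hpos')
      (((WL2.linearEquiv ℂ ℂ (fun _ : TSite d m => c₁)).symm.toLinearMap ∘ₗ QprimeTowerW L m n φ U (c₀ := c₀)) (GpOfUk L m n φ η U a' (c₁ := c₁) hpos' f)))
    (S := S) (Sinv := Sinv) (Sd := LinearMap.adjoint Sinv) (PM := PM) (PN := PN) (Tp := Tp) (Tm := Tm) (V := SG) (W' := LinearMap.adjoint SG)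
    (fun x => by rw [LinearMap.sub_apply, LinearMap.id_apply, sub_sub_cancel])
    (fun f => by rw [LinearMap.sub_apply, LinearMap.id_apply]; exact one_sub_RofUk_apply_eq L m n φ c₀ η U c₁ a' hRS hpos' f)
    (fun g => by rw [LinearMap.sub_apply, LinearMap.id_apply]; exact one_sub_RofUk_fix L m n φ c₀ η U c₁ a' hRS hpos' g)
    (fun x y => by rw [LinearMap.sub_apply, LinearMap.id_apply, LinearMap.sub_apply, LinearMap.id_apply]; exact inner_one_sub_RofUk_left L m n φ c₀ η U x y)
    hκ₁ (sq_mul_norm_sq_le_norm_GQk_sq L m n φ c₀ η U c₁ a' hRS hpos' hκ) (S_Sinv hS hSinv) hdual hV hPAp hfixp hsap hsA0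
    (norm_Akp_sub_Ak_le hφ hφ' hMφ hMφ' hη hU ha' hRS hpos' hCQ hQ hℓ hℓ' hχ hχ' hwin hwin' hS hSinv hSB hSBinv hSG hSGinv hγ hγ1 hM hβ hβ1 coercive hMQ
      hβD hβQ small)
    hwinκ hAm hPAm hfixm hsam hsA0
    (norm_Akm_sub_Ak_le hφ hφ' hMφ hMφ' hη hU ha' hRS hpos' hCQ hQ hℓ hℓ' hχ hχ' hwin hwin' hS hSinv hSB hSBinv hSG hSGinv hγ hγ1 hM hβ hβ1 coercive hMQ
      hβD hβQ small)
    hwinκ x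
  exact h

end Literature.MathematicalPhysics.QuantumFieldTheory.Balaban1983to89.B9Eq349ConjugatedProjectionDifferenceChainTower

end
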